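import Summits.Langlands.Langlands.Theses.NewtonPatching
import Summits.Langlands.Langlands.Theorems.IrreducibilityBySelfDualityReciprocityUpToIrreducibilityCorrespondsConj
import HarnessLib

/-!
# `NewtonPatching.WeakToStrong` (item stmt-Langlands-2383): a.e. Satake–Frobenius compatibility of an
# IRREDUCIBLE `ρ` with an L-algebraic cuspidal `π` upgrades to `Corresponds` at every finite place,
# given direction (A) for `(n, K, RD)`

Proof: (A) gives some `ρ'` with `Corresponds RD ι π ρ'`; by the weak-to-strong upgrade
`ReciprocityUpToIrreducibility.corresponds_of_exists_corresponds` (Chebotarev + Brauer–Nesbitt: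
`ρ'` is irreducible by transfer, hence conjugate to `ρ`; `Corresponds` — Satake clause AND local–global
compatibility at every finite place, including the Weil–Deligne representation of the
Grothendieck–Deligne recipe at `v ∤ ℓ` and the pinned `D_pst` datum at `v ∣ ℓ` — is invariant under a
change of frame, `…CorrespondsConj`) the given `ρ` corresponds to `π`.  The irreducibility and
uniqueness clauses of (A) are not used.  No definitions; std axioms.
-/

noncomputable section

set_option linter.dupNamespace false -- project-wide option (lakefile weak.linter.dupNamespace); `Summit.Langlands.Langlands` is the mandated namespace

namespace Summit.Langlands.Langlands.Theorems.WeakToStrong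

/-- **`WeakToStrong` holds** (route NewtonPatching, item stmt-Langlands-2383): if (A) holds for
`(n, K, RD)` and an irreducible `ρ` is Satake–Frobenius compatible at almost all places with an
L-algebraic cuspidal `π`, then `Corresponds RD ι π ρ` at every finite place.
[cite: DeligneSerreASENS1974, Lemme 3.2] -/
theorem weakToStrong_proof : Summit.Langlands.Langlands.Theses.NewtonPatching.WeakToStrong := by
  intro K _ _ n hcpt RD ℓ _ ι π ρ hA hL hirr hρ
  obtain ⟨ρ', -, -, hcorr, -⟩ := hA π hL ℓ ι
  exact ReciprocityUpToIrreducibility.corresponds_of_exists_corresponds hirr hρ ⟨ρ', hcorr⟩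

end Summit.Langlands.Langlands.Theorems.WeakToStrong

end
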